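import Summits.NavierStokesRegularity.NavierStokesRegularity.Theorems.ExtremiserTransienceNearExtremalTransienceExtremiserLiouvilleConstantSpeedSlideInequalityLayer
import Summits.NavierStokesRegularity.NavierStokesRegularity.Theorems.ExtremiserTransienceNearExtremalTransienceExtremiserLiouvilleConstantSpeedSlideEnstrophyCoercive
import Summits.NavierStokesRegularity.NavierStokesRegularity.Theorems.ExtremiserTransienceNearExtremalTransienceExtremiserLiouvilleConstantSpeedSlideJetKinematicsIntegrated
import Summits.NavierStokesRegularity.NavierStokesRegularity.Theorems.ExtremiserTransienceNearExtremalTransienceExtremiserLiouvilleConstantSpeedSlideEnstrophyLineCoercive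
import HarnessLib

/-!
# Crux `ExtremiserTransience.NearExtremalTransience` (stmt-NavierStokesRegularity-21883), line `extremiser_liouville`,
# stub K1b — THE `W′`-LINE OF R6b, CORRECT ORIENTATION: `A + 2B + 2C ≥ ¼∫γ|Dv|²_F` (record §15/§17/§18; erratum to §18 add. 2)

`--supports stmt-NavierStokesRegularity-21883` (helper).  Author: prover seat `ns-el-k1b` (g9).

ERRATUM.  In (INEQ)₃ (`slideInequality_layer`) the palinstrophy `Pal` multiplies `X_W = −(A + 2B + 2C)` — the minus sign embraces all
three integrals (`A = ∫γ[(3/2)|∂₂V_h|² + ½ω₂² − ½|∇_hV₂|² − ⟪∇_hV₂,∂₂V_h⟫]`, `B = ∫γ(∂₂V₂)²`, `C = ∫γ⟪∇_hV₂,∂₂V_h⟫`, `γ = g′`).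
`…SlideEnstrophyLineCoercive.enstrophyLine_coercive` bounds `A − 2B − 2C` from below, which is true but is NOT the bracket of (INEQ)₃.
This file proves the bound that the absorption ledger actually uses,
```
  ¼ ∫γ(x₂)|Dv|²_F ≤ A + 2B + 2C        (so  Pal·X_W ≤ −(Pal/4)∫γ|Dv|²_F),
```
for the constant-speed jet (`‖v‖ ≡ M`, `c = (0,0,c₂)`, `‖c‖ = M`) with `‖v − c‖ ≤ σ ≤ M/10` on `supp γ∘x₂` — same method: planar enstrophy
identity (p737286) for `ω₂²`, kinematic smallness of `|∇_hV₂|²`, `(∂₂V₂)²` (p743218), Young for the cross term; here `B ≥ 0` helps.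
* `enstrophyLine_lower` : the displayed inequality, integrand shapes those of (INEQ)₃.

WHAT THIS IS NOT: K1b is NOT proved; nothing here proves NS regularity. [folklore]
-/

noncomputable section

open Set Filter Topology MeasureTheory Metric Function InnerProductSpace
open scoped ENNReal NNReal Topology InnerProductSpace RealInnerProductSpace ContDiff
open Literature.Analysis.FluidPDE Literature.Analysis

namespace Summit.NavierStokesRegularity.NavierStokesRegularity.Theorems

-- the problem directory repeats the summit name (`NavierStokesRegularity/NavierStokesRegularity`)
set_option linter.dupNamespace false

namespace ExtremiserLiouville

open DepletionLadder.KStar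

variable {v : EuclideanSpace ℝ (Fin 3) → EuclideanSpace ℝ (Fin 3)} {c : EuclideanSpace ℝ (Fin 3)} {γ : ℝ → ℝ}

/-- **The `W′`-line, correct orientation.**  Constant speed `‖v‖ ≡ M > 0`, divergence free, `c = (0,0,c₂)` with `‖c‖ = M`;
axial weight `γ ∈ C¹`, `0 ≤ γ ≤ K`, `γ = 0` for `|s| > T`; `‖v − c‖ ≤ σ` wherever `γ(x₂) ≠ 0`, with `10σ ≤ M`; `Dv ∈ L²` and
`‖v − c‖²` integrable on the slab `{|x₂| ≤ T}`.  Then `¼∫γ|Dv|²_F ≤ A + 2B + 2C` (notation of the file header). [folklore] -/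
theorem enstrophyLine_lower (hv : ContDiff ℝ ∞ v) (hdiv : VectorCalculus.IsDivFree v) {M : ℝ} (hMpos : 0 < M)
    (hM : ∀ x, ‖v x‖ = M) (hc0 : c 0 = 0) (hc1 : c 1 = 0) (hcM : ‖c‖ = M)
    (hγ : ContDiff ℝ 1 γ) {K T σ : ℝ} (hγ0 : ∀ s, 0 ≤ γ s) (hγK : ∀ s, γ s ≤ K) (hγT : ∀ s, T < |s| → γ s = 0)
    (hσM : 10 * σ ≤ M) (hσ : ∀ x : EuclideanSpace ℝ (Fin 3), γ (x 2) ≠ 0 → ‖v x - c‖ ≤ σ)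
    (h1 : ∫⁻ x, ‖iteratedFDeriv ℝ 1 v x‖ₑ ^ 2 < ⊤)
    (hslab : Integrable (fun x => {x : EuclideanSpace ℝ (Fin 3) | |x 2| ≤ T}.indicator (fun x => ‖v x - c‖ ^ 2) x) volume) :
    (1 / 4) * (∫ x : EuclideanSpace ℝ (Fin 3), γ (x 2) * frobeniusNormSq (fderiv ℝ v x)) ≤ (∫ x : EuclideanSpace ℝ (Fin 3), γ (x 2) * ((3 / 2) * (fderiv ℝ v x (EuclideanSpace.single (2 : Fin 3) (1 : ℝ)) 0 ^ 2 + fderiv ℝ v x (EuclideanSpace.single (2 : Fin 3) (1 : ℝ)) 1 ^ 2) + (1 / 2) * curl v x 2 ^ 2 - (1 / 2) * (fderiv ℝ v x (EuclideanSpace.single (0 : Fin 3) (1 : ℝ)) 2 ^ 2 + fderiv ℝ v x (EuclideanSpace.single (1 : Fin 3) (1 : ℝ)) 2 ^ 2) - (fderiv ℝ v x (EuclideanSpace.single (0 : Fin 3) (1 : ℝ)) 2 * fderiv ℝ v x (EuclideanSpace.single (2 : Fin 3) (1 : ℝ)) 0 + fderiv ℝ v x (EuclideanSpace.single (1 : Fin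 3) (1 : ℝ)) 2 * fderiv ℝ v x (EuclideanSpace.single (2 : Fin 3) (1 : ℝ)) 1))) + 2 * (∫ x : EuclideanSpace ℝ (Fin 3), γ (x 2) * fderiv ℝ v x (EuclideanSpace.single (2 : Fin 3) (1 : ℝ)) 2 ^ 2) + 2 * (∫ x : EuclideanSpace ℝ (Fin 3), γ (x 2) * (fderiv ℝ v x (EuclideanSpace.single (0 : Fin 3) (1 : ℝ)) 2 * fderiv ℝ v x (EuclideanSpace.single (2 : Fin 3) (1 : ℝ)) 0 + fderiv ℝ v x (EuclideanSpace.single (1 : Fin 3) (1 : ℝ)) 2 * fderiv ℝ v x (EuclideanSpace.single (2 : Fin 3) (1 : ℝ)) 1)) := by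
  have hγK' : ∀ s, |γ s| ≤ K := fun s => by rw [abs_of_nonneg (hγ0 s)]; exact hγK s
  have hK0 : 0 ≤ K := (hγ0 0).trans (hγK 0)
  have hvd : Differentiable ℝ v := hv.differentiable (by simp)
  -- the planar enstrophy identity for `V = v − c`
  have hVs : ContDiff ℝ ∞ (fun y => v y - c) := hv.sub contDiff_const
  have h1V : ∫⁻ x, ‖iteratedFDeriv ℝ 1 (fun y => v y - c) x‖ₑ ^ 2 < ⊤ := by
    have e : (fun x => ‖iteratedFDeriv ℝ 1 (fun y => v y - c) x‖ₑ ^ 2) = fun x => ‖iteratedFDeriv ℝ 1 v x‖ₑ ^ 2 := by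
      funext x; rw [iteratedFDeriv_sub_const_of_ne hv c one_ne_zero]
    rw [e]; exact h1
  have hplanar := integral_axialWeight_curl_two_sq_eq (V := fun y => v y - c) hVs (isDivFree_sub_const hdiv c) hγ hγK' hγT h1V hslab
  simp only [curl_sub_const, fderiv_sub_const] at hplanar
  -- `Dv ∈ L²`
  have hD1 : Integrable (fun x => ‖iteratedFDeriv ℝ 1 v x‖ ^ 2) (volume : Measure (EuclideanSpace ℝ (Fin 3))) :=
    integrable_sq_norm_of_lintegral (hv.continuous_iteratedFDeriv (WithTop.coe_le_coe.mpr le_top)) h1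
  have i1 : Integrable (fun x => ‖fderiv ℝ v x‖ ^ 2) (volume : Measure (EuclideanSpace ℝ (Fin 3))) :=
    hD1.congr (Eventually.of_forall fun x => by simp only; rw [← norm_iteratedFDeriv_fderiv, norm_iteratedFDeriv_zero])
  -- continuity and pointwise bounds of the entries of `Dv`
  have cw : Continuous fun x : EuclideanSpace ℝ (Fin 3) => γ (x 2) := hγ.continuous.comp (PiLp.continuous_apply 2 _ (2 : Fin 3))
  have hDi : ∀ (u : EuclideanSpace ℝ (Fin 3)) (i : Fin 3), Continuous fun y => fderiv ℝ v y u i := fun u i =>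
    ((EuclideanSpace.proj i : EuclideanSpace ℝ (Fin 3) →L[ℝ] ℝ).contDiff.comp
      ((hv.fderiv_right (m := ∞) (by exact_mod_cast le_rfl)).clm_apply contDiff_const)).continuous
  have ns : ∀ a : Fin 3, ‖EuclideanSpace.single a (1 : ℝ)‖ = 1 := fun a => by rw [PiLp.norm_single, norm_one]
  have bd : ∀ (x : EuclideanSpace ℝ (Fin 3)) (a i : Fin 3), |fderiv ℝ v x (EuclideanSpace.single a (1 : ℝ)) i| ≤ ‖fderiv ℝ v x‖ := fun x a i => by
    have h1' : |fderiv ℝ v x (EuclideanSpace.single a (1 : ℝ)) i| ≤ ‖fderiv ℝ v x (EuclideanSpace.single a (1 : ℝ))‖ := by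
      simpa [Real.norm_eq_abs] using PiLp.norm_apply_le (fderiv ℝ v x (EuclideanSpace.single a (1 : ℝ))) i
    refine h1'.trans ?_
    simpa [ns a] using (fderiv ℝ v x).le_opNorm (EuclideanSpace.single a (1 : ℝ))
  have hpr : ∀ a i b j : Fin 3, Integrable (fun x : EuclideanSpace ℝ (Fin 3) => γ (x 2) *
      (fderiv ℝ v x (EuclideanSpace.single a (1 : ℝ)) i * fderiv ℝ v x (EuclideanSpace.single b (1 : ℝ)) j)) volume := by
    intro a i b j
    refine (i1.const_mul K).mono' (cw.mul ((hDi _ _).mul (hDi _ _))).aestronglyMeasurable (Eventually.of_forall fun x => ?_)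
    rw [Real.norm_eq_abs, abs_mul, abs_mul]
    have hP := norm_nonneg (fderiv ℝ v x)
    calc |γ (x 2)| * (|fderiv ℝ v x (EuclideanSpace.single a (1 : ℝ)) i| * |fderiv ℝ v x (EuclideanSpace.single b (1 : ℝ)) j|)
        ≤ K * (‖fderiv ℝ v x‖ * ‖fderiv ℝ v x‖) :=
          mul_le_mul (hγK' _) (mul_le_mul (bd x a i) (bd x b j) (abs_nonneg _) hP) (by positivity) hK0
      _ = K * ‖fderiv ℝ v x‖ ^ 2 := by ring
  have hsq : ∀ a i : Fin 3, Integrable (fun x : EuclideanSpace ℝ (Fin 3) => γ (x 2) * fderiv ℝ v x (EuclideanSpace.single a (1 : ℝ)) i ^ 2) volume :=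
    fun a i => (hpr a i a i).congr (Eventually.of_forall fun x => by simp only; ring)
  have hω : Integrable (fun x : EuclideanSpace ℝ (Fin 3) => γ (x 2) * curl v x 2 ^ 2) volume := by
    have h := ((hsq 0 1).add (hsq 1 0)).sub ((hpr 0 1 1 0).const_mul 2)
    refine h.congr (Eventually.of_forall fun x => ?_)
    simp only [Pi.add_apply, Pi.sub_apply, curl_apply_two]
    ring
  -- the named weighted integrals
  have iH : Integrable (fun x : EuclideanSpace ℝ (Fin 3) => γ (x 2) * (fderiv ℝ v x (EuclideanSpace.single (0 : Fin 3) (1 : ℝ)) 0 ^ 2 + fderiv ℝ v x (EuclideanSpace.single (1 : Fin 3) (1 : ℝ)) 0 ^ 2 + fderiv ℝ v x (EuclideanSpace.single (0 : Fin 3) (1 : ℝ)) 1 ^ 2 + fderiv ℝ v x (EuclideanSpace.single (1 : Fin 3) (1 : ℝ)) 1 ^ 2)) volume :=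
    (((hsq 0 0).add (hsq 1 0)).add ((hsq 0 1).add (hsq 1 1))).congr (Eventually.of_forall fun x => by simp only [Pi.add_apply]; ring)
  have iP : Integrable (fun x : EuclideanSpace ℝ (Fin 3) => γ (x 2) * (fderiv ℝ v x (EuclideanSpace.single (2 : Fin 3) (1 : ℝ)) 0 ^ 2 + fderiv ℝ v x (EuclideanSpace.single (2 : Fin 3) (1 : ℝ)) 1 ^ 2)) volume :=
    ((hsq 2 0).add (hsq 2 1)).congr (Eventually.of_forall fun x => by simp only [Pi.add_apply]; ring)
  have iQ : Integrable (fun x : EuclideanSpace ℝ (Fin 3) => γ (x 2) * (fderiv ℝ v x (EuclideanSpace.single (0 : Fin 3) (1 : ℝ)) 2 ^ 2 + fderiv ℝ v x (EuclideanSpace.single (1 : Fin 3) (1 : ℝ)) 2 ^ 2)) volume :=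
    ((hsq 0 2).add (hsq 1 2)).congr (Eventually.of_forall fun x => by simp only [Pi.add_apply]; ring)
  have iR : Integrable (fun x : EuclideanSpace ℝ (Fin 3) => γ (x 2) * fderiv ℝ v x (EuclideanSpace.single (2 : Fin 3) (1 : ℝ)) 2 ^ 2) volume := hsq 2 2
  have iX : Integrable (fun x : EuclideanSpace ℝ (Fin 3) => γ (x 2) * (fderiv ℝ v x (EuclideanSpace.single (0 : Fin 3) (1 : ℝ)) 2 * fderiv ℝ v x (EuclideanSpace.single (2 : Fin 3) (1 : ℝ)) 0 + fderiv ℝ v x (EuclideanSpace.single (1 : Fin 3) (1 : ℝ)) 2 * fderiv ℝ v x (EuclideanSpace.single (2 : Fin 3) (1 : ℝ)) 1)) volume :=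
    ((hpr 0 2 2 0).add (hpr 1 2 2 1)).congr (Eventually.of_forall fun x => by simp only [Pi.add_apply]; ring)
  -- `|Dv|²_F = h + q + p + r` pointwise
  have hFrob : ∀ x : EuclideanSpace ℝ (Fin 3), frobeniusNormSq (fderiv ℝ v x) = (fderiv ℝ v x (EuclideanSpace.single (0 : Fin 3) (1 : ℝ)) 0 ^ 2 + fderiv ℝ v x (EuclideanSpace.single (1 : Fin 3) (1 : ℝ)) 0 ^ 2 + fderiv ℝ v x (EuclideanSpace.single (0 : Fin 3) (1 : ℝ)) 1 ^ 2 + fderiv ℝ v x (EuclideanSpace.single (1 : Fin 3) (1 : ℝ)) 1 ^ 2) + (fderiv ℝ v x (EuclideanSpace.single (0 : Fin 3) (1 : ℝ)) 2 ^ 2 + fderiv ℝ v x (EuclideanSpace.single (1 : Fin 3) (1 : ℝ)) 2 ^ 2) + (fderiv ℝ v x (EuclideanSpace.single (2 : Fin 3) (1 : ℝ)) 0 ^ 2 + fderiv ℝ v x (EuclideanSpace.single (2 : Fin 3) (1 : ℝ)) 1 ^ 2) + fderiv ℝ v x (EuclideanSpace.single (2 : Fin 3) (1 : ℝ)) 2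 ^ 2 := fun x => by
    rw [frobeniusNormSq_eq_sum (EuclideanSpace.basisFun (Fin 3) ℝ), Fin.sum_univ_three]
    simp only [EuclideanSpace.basisFun_apply, EuclideanSpace.norm_sq_eq, Real.norm_eq_abs, sq_abs, Fin.sum_univ_three]
    ring
  have iF : Integrable (fun x : EuclideanSpace ℝ (Fin 3) => γ (x 2) * frobeniusNormSq (fderiv ℝ v x)) volume :=
    (((iH.add iQ).add iP).add iR).congr (Eventually.of_forall fun x => by simp only [Pi.add_apply]; rw [hFrob x]; ring)
  have eF : (∫ x : EuclideanSpace ℝ (Fin 3), γ (x 2) * frobeniusNormSq (fderiv ℝ v x)) = (∫ x : EuclideanSpace ℝ (Fin 3), γ (x 2) * (fderiv ℝ v x (EuclideanSpace.single (0 : Fin 3) (1 : ℝ)) 0 ^ 2 + fderiv ℝ v x (EuclideanSpace.single (1 : Fin 3) (1 : ℝ)) 0 ^ 2 + fderiv ℝ v x (EuclideanSpace.single (0 : Fin 3) (1 : ℝ)) 1 ^ 2 + fderiv ℝ v x (EuclideanSpace.single (1 : Fin 3) (1 : ℝ)) 1 ^ 2)) + (∫ x : EuclideanSpace ℝ (Fin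 3), γ (x 2) * (fderiv ℝ v x (EuclideanSpace.single (0 : Fin 3) (1 : ℝ)) 2 ^ 2 + fderiv ℝ v x (EuclideanSpace.single (1 : Fin 3) (1 : ℝ)) 2 ^ 2)) + (∫ x : EuclideanSpace ℝ (Fin 3), γ (x 2) * (fderiv ℝ v x (EuclideanSpace.single (2 : Fin 3) (1 : ℝ)) 0 ^ 2 + fderiv ℝ v x (EuclideanSpace.single (2 : Fin 3) (1 : ℝ)) 1 ^ 2)) + ∫ x : EuclideanSpace ℝ (Fin 3), γ (x 2) * fderiv ℝ v x (EuclideanSpace.single (2 : Fin 3) (1 : ℝ)) 2 ^ 2 := by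
    have e1 : (∫ x : EuclideanSpace ℝ (Fin 3), γ (x 2) * frobeniusNormSq (fderiv ℝ v x)) = ∫ x : EuclideanSpace ℝ (Fin 3), (γ (x 2) * (fderiv ℝ v x (EuclideanSpace.single (0 : Fin 3) (1 : ℝ)) 0 ^ 2 + fderiv ℝ v x (EuclideanSpace.single (1 : Fin 3) (1 : ℝ)) 0 ^ 2 + fderiv ℝ v x (EuclideanSpace.single (0 : Fin 3) (1 : ℝ)) 1 ^ 2 + fderiv ℝ v x (EuclideanSpace.single (1 : Fin 3) (1 : ℝ)) 1 ^ 2) + γ (x 2) * (fderiv ℝ v x (EuclideanSpace.single (0 : Fin 3) (1 : ℝ)) 2 ^ 2 + fderiv ℝ v x (EuclideanSpace.single (1 : Fin 3) (1 : ℝ)) 2 ^ 2) + γ (x 2) * (fderiv ℝ v x (EuclideanSpace.single (2 : Fin 3) (1 : ℝ)) 0 ^ 2 + fderiv ℝ v x (EuclideanSpace.single (2 : Fin 3) (1 : ℝ)) 1 ^ 2) + γ (x 2) * fderiv ℝ v x (EuclideanSpace.single (2 : Fin 3) (1 : ℝ)) 2 ^ 2) :=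
      integral_congr_ae (Eventually.of_forall fun x => by simp only; rw [hFrob x]; ring)
    have iHQ : Integrable (fun x : EuclideanSpace ℝ (Fin 3) => γ (x 2) * (fderiv ℝ v x (EuclideanSpace.single (0 : Fin 3) (1 : ℝ)) 0 ^ 2 + fderiv ℝ v x (EuclideanSpace.single (1 : Fin 3) (1 : ℝ)) 0 ^ 2 + fderiv ℝ v x (EuclideanSpace.single (0 : Fin 3) (1 : ℝ)) 1 ^ 2 + fderiv ℝ v x (EuclideanSpace.single (1 : Fin 3) (1 : ℝ)) 1 ^ 2) + γ (x 2) * (fderiv ℝ v x (EuclideanSpace.single (0 : Fin 3) (1 : ℝ)) 2 ^ 2 + fderiv ℝ v x (EuclideanSpace.single (1 : Fin 3) (1 : ℝ)) 2 ^ 2)) volume := iH.add iQ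
    have iHQP : Integrable (fun x : EuclideanSpace ℝ (Fin 3) => γ (x 2) * (fderiv ℝ v x (EuclideanSpace.single (0 : Fin 3) (1 : ℝ)) 0 ^ 2 + fderiv ℝ v x (EuclideanSpace.single (1 : Fin 3) (1 : ℝ)) 0 ^ 2 + fderiv ℝ v x (EuclideanSpace.single (0 : Fin 3) (1 : ℝ)) 1 ^ 2 + fderiv ℝ v x (EuclideanSpace.single (1 : Fin 3) (1 : ℝ)) 1 ^ 2) + γ (x 2) * (fderiv ℝ v x (EuclideanSpace.single (0 : Fin 3) (1 : ℝ)) 2 ^ 2 + fderiv ℝ v x (EuclideanSpace.single (1 : Fin 3) (1 : ℝ)) 2 ^ 2) + γ (x 2) * (fderiv ℝ v x (EuclideanSpace.single (2 : Fin 3) (1 : ℝ)) 0 ^ 2 + fderiv ℝ v x (EuclideanSpace.single (2 : Fin 3) (1 : ℝ)) 1 ^ 2)) volume := iHQ.add iP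
    rw [e1, integral_add iHQP iR, integral_add iHQ iP, integral_add iH iQ]
  -- `A` split into the named integrals
  have eA : (∫ x : EuclideanSpace ℝ (Fin 3), γ (x 2) * ((3 / 2) * (fderiv ℝ v x (EuclideanSpace.single (2 : Fin 3) (1 : ℝ)) 0 ^ 2 + fderiv ℝ v x (EuclideanSpace.single (2 : Fin 3) (1 : ℝ)) 1 ^ 2) + (1 / 2) * curl v x 2 ^ 2 - (1 / 2) * (fderiv ℝ v x (EuclideanSpace.single (0 : Fin 3) (1 : ℝ)) 2 ^ 2 + fderiv ℝ v x (EuclideanSpace.single (1 : Fin 3) (1 : ℝ)) 2 ^ 2) - (fderiv ℝ v x (EuclideanSpace.single (0 : Fin 3) (1 : ℝ)) 2 * fderiv ℝ v x (EuclideanSpace.single (2 : Fin 3) (1 : ℝ)) 0 + fderiv ℝ v x (EuclideanSpace.single (1 : Fin 3) (1 : ℝ)) 2 * fderiv ℝ v x (EuclideanSpace.single (2 : Fin 3) (1 : ℝ)) 1))) = (3 / 2) * (∫ x : EuclideanSpace ℝ (Fin 3), γ (x 2) * (fderiv ℝ v x (EuclideanSpace.single (2 : Fin 3) (1 : ℝ))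 0 ^ 2 + fderiv ℝ v x (EuclideanSpace.single (2 : Fin 3) (1 : ℝ)) 1 ^ 2)) + (1 / 2) * (∫ x : EuclideanSpace ℝ (Fin 3), γ (x 2) * curl v x 2 ^ 2) - (1 / 2) * (∫ x : EuclideanSpace ℝ (Fin 3), γ (x 2) * (fderiv ℝ v x (EuclideanSpace.single (0 : Fin 3) (1 : ℝ)) 2 ^ 2 + fderiv ℝ v x (EuclideanSpace.single (1 : Fin 3) (1 : ℝ)) 2 ^ 2)) -
      ∫ x : EuclideanSpace ℝ (Fin 3), γ (x 2) * (fderiv ℝ v x (EuclideanSpace.single (0 : Fin 3) (1 : ℝ)) 2 * fderiv ℝ v x (EuclideanSpace.single (2 : Fin 3) (1 : ℝ)) 0 + fderiv ℝ v x (EuclideanSpace.single (1 : Fin 3) (1 : ℝ)) 2 * fderiv ℝ v x (EuclideanSpace.single (2 : Fin 3) (1 : ℝ)) 1) := by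
    have e1 : (∫ x : EuclideanSpace ℝ (Fin 3), γ (x 2) * ((3 / 2) * (fderiv ℝ v x (EuclideanSpace.single (2 : Fin 3) (1 : ℝ)) 0 ^ 2 + fderiv ℝ v x (EuclideanSpace.single (2 : Fin 3) (1 : ℝ)) 1 ^ 2) + (1 / 2) * curl v x 2 ^ 2 - (1 / 2) * (fderiv ℝ v x (EuclideanSpace.single (0 : Fin 3) (1 : ℝ)) 2 ^ 2 + fderiv ℝ v x (EuclideanSpace.single (1 : Fin 3) (1 : ℝ)) 2 ^ 2) - (fderiv ℝ v x (EuclideanSpace.single (0 : Fin 3) (1 : ℝ)) 2 * fderiv ℝ v x (EuclideanSpace.single (2 : Fin 3) (1 : ℝ)) 0 + fderiv ℝ v x (EuclideanSpace.single (1 : Fin 3) (1 : ℝ)) 2 * fderiv ℝ v x (EuclideanSpace.single (2 : Fin 3) (1 : ℝ)) 1))) = ∫ x : EuclideanSpace ℝ (Fin 3), ((3 / 2) * (γ (x 2) * (fderiv ℝ v x (EuclideanSpace.single (2 : Fin 3) (1 : ℝ)) 0 ^ 2 + fderiv ℝ v x (EuclideanSpace.single (2 : Fin 3) (1 : ℝ))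 1 ^ 2)) + (1 / 2) * (γ (x 2) * curl v x 2 ^ 2) - (1 / 2) * (γ (x 2) * (fderiv ℝ v x (EuclideanSpace.single (0 : Fin 3) (1 : ℝ)) 2 ^ 2 + fderiv ℝ v x (EuclideanSpace.single (1 : Fin 3) (1 : ℝ)) 2 ^ 2)) - γ (x 2) * (fderiv ℝ v x (EuclideanSpace.single (0 : Fin 3) (1 : ℝ)) 2 * fderiv ℝ v x (EuclideanSpace.single (2 : Fin 3) (1 : ℝ)) 0 + fderiv ℝ v x (EuclideanSpace.single (1 : Fin 3) (1 : ℝ)) 2 * fderiv ℝ v x (EuclideanSpace.single (2 : Fin 3) (1 : ℝ)) 1)) :=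
      integral_congr_ae (Eventually.of_forall fun x => by simp only; ring)
    have j1 : Integrable (fun x : EuclideanSpace ℝ (Fin 3) => (3 / 2) * (γ (x 2) * (fderiv ℝ v x (EuclideanSpace.single (2 : Fin 3) (1 : ℝ)) 0 ^ 2 + fderiv ℝ v x (EuclideanSpace.single (2 : Fin 3) (1 : ℝ)) 1 ^ 2))) volume := iP.const_mul _
    have j2 : Integrable (fun x : EuclideanSpace ℝ (Fin 3) => (1 / 2) * (γ (x 2) * curl v x 2 ^ 2)) volume := hω.const_mul _
    have j3 : Integrable (fun x : EuclideanSpace ℝ (Fin 3) => (1 / 2) * (γ (x 2) * (fderiv ℝ v x (EuclideanSpace.single (0 : Fin 3) (1 : ℝ)) 2 ^ 2 + fderiv ℝ v x (EuclideanSpace.single (1 : Fin 3) (1 : ℝ)) 2 ^ 2))) volume := iQ.const_mul _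
    have j12 : Integrable (fun x : EuclideanSpace ℝ (Fin 3) => (3 / 2) * (γ (x 2) * (fderiv ℝ v x (EuclideanSpace.single (2 : Fin 3) (1 : ℝ)) 0 ^ 2 + fderiv ℝ v x (EuclideanSpace.single (2 : Fin 3) (1 : ℝ)) 1 ^ 2)) + (1 / 2) * (γ (x 2) * curl v x 2 ^ 2)) volume := j1.add j2
    have j123 : Integrable (fun x : EuclideanSpace ℝ (Fin 3) => (3 / 2) * (γ (x 2) * (fderiv ℝ v x (EuclideanSpace.single (2 : Fin 3) (1 : ℝ)) 0 ^ 2 + fderiv ℝ v x (EuclideanSpace.single (2 : Fin 3) (1 : ℝ)) 1 ^ 2)) + (1 / 2) * (γ (x 2) * curl v x 2 ^ 2) - (1 / 2) * (γ (x 2) * (fderiv ℝ v x (EuclideanSpace.single (0 : Fin 3) (1 : ℝ)) 2 ^ 2 + fderiv ℝ v x (EuclideanSpace.single (1 : Fin 3) (1 : ℝ)) 2 ^ 2))) volume := j12.sub j3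
    rw [e1, integral_sub j123 iX, integral_sub j12 j3, integral_add j1 j2, integral_const_mul, integral_const_mul, integral_const_mul]
  -- jet kinematics: `c₂² = M²`, and the weighted smallness of the `V₂`-entries
  have kin : ∀ (x : EuclideanSpace ℝ (Fin 3)) (a : Fin 3), M ^ 2 * fderiv ℝ v x (EuclideanSpace.single a (1 : ℝ)) 2 ^ 2 ≤
      ‖v x - c‖ ^ 2 * (fderiv ℝ v x (EuclideanSpace.single a (1 : ℝ)) 0 ^ 2 + fderiv ℝ v x (EuclideanSpace.single a (1 : ℝ)) 1 ^ 2 +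
        fderiv ℝ v x (EuclideanSpace.single a (1 : ℝ)) 2 ^ 2) := fun x a => by
    have h2 := sq_mul_sq_fderiv_apply_two_le hvd hM hc0 hc1 hcM x (EuclideanSpace.single a (1 : ℝ))
    have hn : ‖fderiv ℝ v x (EuclideanSpace.single a (1 : ℝ))‖ ^ 2 = fderiv ℝ v x (EuclideanSpace.single a (1 : ℝ)) 0 ^ 2 +
        fderiv ℝ v x (EuclideanSpace.single a (1 : ℝ)) 1 ^ 2 + fderiv ℝ v x (EuclideanSpace.single a (1 : ℝ)) 2 ^ 2 := by
      rw [EuclideanSpace.norm_sq_eq, Fin.sum_univ_three]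
      simp only [Real.norm_eq_abs, sq_abs]
    rw [hn] at h2
    exact h2
  have hVσ : ∀ x : EuclideanSpace ℝ (Fin 3), γ (x 2) * ‖v x - c‖ ^ 2 ≤ γ (x 2) * (M ^ 2 / 100) := fun x => by
    by_cases h0 : γ (x 2) = 0
    · rw [h0, zero_mul, zero_mul]
    · have hs := hσ x h0
      have hσ0 : 0 ≤ σ := (norm_nonneg _).trans hs
      have : ‖v x - c‖ ^ 2 ≤ σ ^ 2 := pow_le_pow_left₀ (norm_nonneg _) hs 2
      have : σ ^ 2 ≤ M ^ 2 / 100 := by nlinarith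
      exact mul_le_mul_of_nonneg_left (by linarith) (hγ0 _)
  -- pointwise weighted inequalities (b), (c), (d)
  have pb : ∀ x : EuclideanSpace ℝ (Fin 3), γ (x 2) * (fderiv ℝ v x (EuclideanSpace.single (0 : Fin 3) (1 : ℝ)) 2 ^ 2 + fderiv ℝ v x (EuclideanSpace.single (1 : Fin 3) (1 : ℝ)) 2 ^ 2) ≤ (1 / 100) * (γ (x 2) * (fderiv ℝ v x (EuclideanSpace.single (0 : Fin 3) (1 : ℝ)) 0 ^ 2 + fderiv ℝ v x (EuclideanSpace.single (1 : Fin 3) (1 : ℝ)) 0 ^ 2 + fderiv ℝ v x (EuclideanSpace.single (0 : Fin 3) (1 : ℝ)) 1 ^ 2 + fderiv ℝ v x (EuclideanSpace.single (1 : Fin 3) (1 : ℝ)) 1 ^ 2) + γ (x 2) * (fderiv ℝ v x (EuclideanSpace.single (0 : Fin 3) (1 : ℝ)) 2 ^ 2 + fderiv ℝ v x (EuclideanSpace.single (1 : Fin 3) (1 : ℝ)) 2 ^ 2)) := fun x =>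
    weighted_small_of_kinematic (n := (fderiv ℝ v x (EuclideanSpace.single (0 : Fin 3) (1 : ℝ)) 0 ^ 2 + fderiv ℝ v x (EuclideanSpace.single (0 : Fin 3) (1 : ℝ)) 1 ^ 2 + fderiv ℝ v x (EuclideanSpace.single (0 : Fin 3) (1 : ℝ)) 2 ^ 2) + (fderiv ℝ v x (EuclideanSpace.single (1 : Fin 3) (1 : ℝ)) 0 ^ 2 + fderiv ℝ v x (EuclideanSpace.single (1 : Fin 3) (1 : ℝ)) 1 ^ 2 + fderiv ℝ v x (EuclideanSpace.single (1 : Fin 3) (1 : ℝ)) 2 ^ 2)) (hγ0 _) hMpos (by linarith [kin x 0, kin x 1]) (hVσ x) (by ring)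
      (by positivity) (by positivity)
  have pc : ∀ x : EuclideanSpace ℝ (Fin 3), γ (x 2) * fderiv ℝ v x (EuclideanSpace.single (2 : Fin 3) (1 : ℝ)) 2 ^ 2 ≤ (1 / 100) * (γ (x 2) * (fderiv ℝ v x (EuclideanSpace.single (2 : Fin 3) (1 : ℝ)) 0 ^ 2 + fderiv ℝ v x (EuclideanSpace.single (2 : Fin 3) (1 : ℝ)) 1 ^ 2) + γ (x 2) * fderiv ℝ v x (EuclideanSpace.single (2 : Fin 3) (1 : ℝ)) 2 ^ 2) := fun x =>
    weighted_small_of_kinematic (n := (fderiv ℝ v x (EuclideanSpace.single (2 : Fin 3) (1 : ℝ)) 0 ^ 2 + fderiv ℝ v x (EuclideanSpace.single (2 : Fin 3) (1 : ℝ)) 1 ^ 2 + fderiv ℝ v x (EuclideanSpace.single (2 : Fin 3) (1 : ℝ)) 2 ^ 2)) (hγ0 _) hMpos (by linarith [kin x 2]) (hVσ x) (by ring) (by positivity) (by positivity)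
  have pd : ∀ x : EuclideanSpace ℝ (Fin 3), |γ (x 2) * (fderiv ℝ v x (EuclideanSpace.single (0 : Fin 3) (1 : ℝ)) 2 * fderiv ℝ v x (EuclideanSpace.single (2 : Fin 3) (1 : ℝ)) 0 + fderiv ℝ v x (EuclideanSpace.single (1 : Fin 3) (1 : ℝ)) 2 * fderiv ℝ v x (EuclideanSpace.single (2 : Fin 3) (1 : ℝ)) 1)| ≤ 5 * (γ (x 2) * (fderiv ℝ v x (EuclideanSpace.single (0 : Fin 3) (1 : ℝ)) 2 ^ 2 + fderiv ℝ v x (EuclideanSpace.single (1 : Fin 3) (1 : ℝ)) 2 ^ 2)) + (1 / 20) * (γ (x 2) * (fderiv ℝ v x (EuclideanSpace.single (2 : Fin 3) (1 : ℝ)) 0 ^ 2 + fderiv ℝ v x (EuclideanSpace.single (2 : Fin 3) (1 : ℝ)) 1 ^ 2)) := fun x => by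
    have hw := hγ0 (x 2)
    rw [abs_mul, abs_of_nonneg hw]
    have hx := abs_cross_le_weighted (fderiv ℝ v x (EuclideanSpace.single (0 : Fin 3) (1 : ℝ)) 2) (fderiv ℝ v x (EuclideanSpace.single (2 : Fin 3) (1 : ℝ)) 0) (fderiv ℝ v x (EuclideanSpace.single (1 : Fin 3) (1 : ℝ)) 2) (fderiv ℝ v x (EuclideanSpace.single (2 : Fin 3) (1 : ℝ)) 1)
    have := mul_le_mul_of_nonneg_left hx hw
    linarith [this]
  -- integrate (b), (c), (d)
  have iHQ : Integrable (fun x : EuclideanSpace ℝ (Fin 3) => (1 / 100) * (γ (x 2) * (fderiv ℝ v x (EuclideanSpace.single (0 : Fin 3) (1 : ℝ)) 0 ^ 2 + fderiv ℝ v x (EuclideanSpace.single (1 : Fin 3) (1 : ℝ)) 0 ^ 2 + fderiv ℝ v x (EuclideanSpace.single (0 : Fin 3) (1 : ℝ)) 1 ^ 2 + fderiv ℝ v x (EuclideanSpace.single (1 : Fin 3) (1 : ℝ)) 1 ^ 2) + γ (x 2) * (fderiv ℝ v x (EuclideanSpace.single (0 : Fin 3) (1 : ℝ)) 2 ^ 2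 + fderiv ℝ v x (EuclideanSpace.single (1 : Fin 3) (1 : ℝ)) 2 ^ 2))) volume := (iH.add iQ).const_mul (1 / 100)
  have iPR : Integrable (fun x : EuclideanSpace ℝ (Fin 3) => (1 / 100) * (γ (x 2) * (fderiv ℝ v x (EuclideanSpace.single (2 : Fin 3) (1 : ℝ)) 0 ^ 2 + fderiv ℝ v x (EuclideanSpace.single (2 : Fin 3) (1 : ℝ)) 1 ^ 2) + γ (x 2) * fderiv ℝ v x (EuclideanSpace.single (2 : Fin 3) (1 : ℝ)) 2 ^ 2)) volume := (iP.add iR).const_mul (1 / 100)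
  have iQP : Integrable (fun x : EuclideanSpace ℝ (Fin 3) => 5 * (γ (x 2) * (fderiv ℝ v x (EuclideanSpace.single (0 : Fin 3) (1 : ℝ)) 2 ^ 2 + fderiv ℝ v x (EuclideanSpace.single (1 : Fin 3) (1 : ℝ)) 2 ^ 2)) + (1 / 20) * (γ (x 2) * (fderiv ℝ v x (EuclideanSpace.single (2 : Fin 3) (1 : ℝ)) 0 ^ 2 + fderiv ℝ v x (EuclideanSpace.single (2 : Fin 3) (1 : ℝ)) 1 ^ 2))) volume := (iQ.const_mul 5).add (iP.const_mul (1 / 20))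
  have eHQ : (∫ x : EuclideanSpace ℝ (Fin 3), (1 / 100) * (γ (x 2) * (fderiv ℝ v x (EuclideanSpace.single (0 : Fin 3) (1 : ℝ)) 0 ^ 2 + fderiv ℝ v x (EuclideanSpace.single (1 : Fin 3) (1 : ℝ)) 0 ^ 2 + fderiv ℝ v x (EuclideanSpace.single (0 : Fin 3) (1 : ℝ)) 1 ^ 2 + fderiv ℝ v x (EuclideanSpace.single (1 : Fin 3) (1 : ℝ)) 1 ^ 2) + γ (x 2) * (fderiv ℝ v x (EuclideanSpace.single (0 : Fin 3) (1 : ℝ)) 2 ^ 2 + fderiv ℝ v x (EuclideanSpace.single (1 : Fin 3) (1 : ℝ)) 2 ^ 2))) = (1 / 100) * ((∫ x : EuclideanSpace ℝ (Fin 3), γ (x 2) * (fderiv ℝ v x (EuclideanSpace.single (0 : Fin 3) (1 : ℝ)) 0 ^ 2 + fderiv ℝ v x (EuclideanSpace.single (1 : Fin 3) (1 : ℝ)) 0 ^ 2 + fderiv ℝ v x (EuclideanSpace.single (0 : Fin 3) (1 : ℝ)) 1 ^ 2 + fderiv ℝ v x (EuclideanSpace.single (1 : Fin 3) (1 : ℝ))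 1 ^ 2)) + ∫ x : EuclideanSpace ℝ (Fin 3), γ (x 2) * (fderiv ℝ v x (EuclideanSpace.single (0 : Fin 3) (1 : ℝ)) 2 ^ 2 + fderiv ℝ v x (EuclideanSpace.single (1 : Fin 3) (1 : ℝ)) 2 ^ 2)) := by
    rw [integral_const_mul, integral_add iH iQ]
  have ePR : (∫ x : EuclideanSpace ℝ (Fin 3), (1 / 100) * (γ (x 2) * (fderiv ℝ v x (EuclideanSpace.single (2 : Fin 3) (1 : ℝ)) 0 ^ 2 + fderiv ℝ v x (EuclideanSpace.single (2 : Fin 3) (1 : ℝ)) 1 ^ 2) + γ (x 2) * fderiv ℝ v x (EuclideanSpace.single (2 : Fin 3) (1 : ℝ)) 2 ^ 2)) = (1 / 100) * ((∫ x : EuclideanSpace ℝ (Fin 3), γ (x 2) * (fderiv ℝ v x (EuclideanSpace.single (2 : Fin 3) (1 : ℝ)) 0 ^ 2 + fderiv ℝ v x (EuclideanSpace.single (2 : Fin 3) (1 : ℝ)) 1 ^ 2)) + ∫ x : EuclideanSpace ℝ (Fin 3), γ (x 2) * fderiv ℝ v x (EuclideanSpace.single (2 : Fin 3) (1 : ℝ))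 2 ^ 2) := by
    rw [integral_const_mul, integral_add iP iR]
  have iQ5 : Integrable (fun x : EuclideanSpace ℝ (Fin 3) => 5 * (γ (x 2) * (fderiv ℝ v x (EuclideanSpace.single (0 : Fin 3) (1 : ℝ)) 2 ^ 2 + fderiv ℝ v x (EuclideanSpace.single (1 : Fin 3) (1 : ℝ)) 2 ^ 2))) volume := iQ.const_mul 5
  have iP20 : Integrable (fun x : EuclideanSpace ℝ (Fin 3) => (1 / 20) * (γ (x 2) * (fderiv ℝ v x (EuclideanSpace.single (2 : Fin 3) (1 : ℝ)) 0 ^ 2 + fderiv ℝ v x (EuclideanSpace.single (2 : Fin 3) (1 : ℝ)) 1 ^ 2))) volume := iP.const_mul (1 / 20)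
  have eQP : (∫ x : EuclideanSpace ℝ (Fin 3), (5 * (γ (x 2) * (fderiv ℝ v x (EuclideanSpace.single (0 : Fin 3) (1 : ℝ)) 2 ^ 2 + fderiv ℝ v x (EuclideanSpace.single (1 : Fin 3) (1 : ℝ)) 2 ^ 2)) + (1 / 20) * (γ (x 2) * (fderiv ℝ v x (EuclideanSpace.single (2 : Fin 3) (1 : ℝ)) 0 ^ 2 + fderiv ℝ v x (EuclideanSpace.single (2 : Fin 3) (1 : ℝ)) 1 ^ 2)))) = 5 * (∫ x : EuclideanSpace ℝ (Fin 3), γ (x 2) * (fderiv ℝ v x (EuclideanSpace.single (0 : Fin 3) (1 : ℝ)) 2 ^ 2 + fderiv ℝ v x (EuclideanSpace.single (1 : Fin 3) (1 : ℝ)) 2 ^ 2)) + (1 / 20) * ∫ x : EuclideanSpace ℝ (Fin 3), γ (x 2) * (fderiv ℝ v x (EuclideanSpace.single (2 : Fin 3) (1 : ℝ)) 0 ^ 2 + fderiv ℝ v x (EuclideanSpace.single (2 : Fin 3) (1 : ℝ)) 1 ^ 2) := by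
    rw [integral_add iQ5 iP20, integral_const_mul, integral_const_mul]
  have Ib : (∫ x : EuclideanSpace ℝ (Fin 3), γ (x 2) * (fderiv ℝ v x (EuclideanSpace.single (0 : Fin 3) (1 : ℝ)) 2 ^ 2 + fderiv ℝ v x (EuclideanSpace.single (1 : Fin 3) (1 : ℝ)) 2 ^ 2)) ≤ (1 / 100) * ((∫ x : EuclideanSpace ℝ (Fin 3), γ (x 2) * (fderiv ℝ v x (EuclideanSpace.single (0 : Fin 3) (1 : ℝ)) 0 ^ 2 + fderiv ℝ v x (EuclideanSpace.single (1 : Fin 3) (1 : ℝ)) 0 ^ 2 + fderiv ℝ v x (EuclideanSpace.single (0 : Fin 3) (1 : ℝ)) 1 ^ 2 + fderiv ℝ v x (EuclideanSpace.single (1 : Fin 3) (1 : ℝ)) 1 ^ 2)) + ∫ x : EuclideanSpace ℝ (Fin 3), γ (x 2) * (fderiv ℝ v x (EuclideanSpace.single (0 : Fin 3) (1 : ℝ)) 2 ^ 2 + fderiv ℝ v x (EuclideanSpace.single (1 : Fin 3) (1 : ℝ)) 2 ^ 2)) := by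
    have := integral_mono iQ iHQ pb
    rwa [eHQ] at this
  have Ic : (∫ x : EuclideanSpace ℝ (Fin 3), γ (x 2) * fderiv ℝ v x (EuclideanSpace.single (2 : Fin 3) (1 : ℝ)) 2 ^ 2) ≤ (1 / 100) * ((∫ x : EuclideanSpace ℝ (Fin 3), γ (x 2) * (fderiv ℝ v x (EuclideanSpace.single (2 : Fin 3) (1 : ℝ)) 0 ^ 2 + fderiv ℝ v x (EuclideanSpace.single (2 : Fin 3) (1 : ℝ)) 1 ^ 2)) + ∫ x : EuclideanSpace ℝ (Fin 3), γ (x 2) * fderiv ℝ v x (EuclideanSpace.single (2 : Fin 3) (1 : ℝ)) 2 ^ 2) := by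
    have := integral_mono iR iPR pc
    rwa [ePR] at this
  have Id : |∫ x : EuclideanSpace ℝ (Fin 3), γ (x 2) * (fderiv ℝ v x (EuclideanSpace.single (0 : Fin 3) (1 : ℝ)) 2 * fderiv ℝ v x (EuclideanSpace.single (2 : Fin 3) (1 : ℝ)) 0 + fderiv ℝ v x (EuclideanSpace.single (1 : Fin 3) (1 : ℝ)) 2 * fderiv ℝ v x (EuclideanSpace.single (2 : Fin 3) (1 : ℝ)) 1)| ≤ 5 * (∫ x : EuclideanSpace ℝ (Fin 3), γ (x 2) * (fderiv ℝ v x (EuclideanSpace.single (0 : Fin 3) (1 : ℝ)) 2 ^ 2 + fderiv ℝ v x (EuclideanSpace.single (1 : Fin 3) (1 : ℝ)) 2 ^ 2)) + (1 / 20) * ∫ x : EuclideanSpace ℝ (Fin 3), γ (x 2) * (fderiv ℝ v x (EuclideanSpace.single (2 : Fin 3) (1 : ℝ)) 0 ^ 2 + fderiv ℝ v x (EuclideanSpace.single (2 : Fin 3) (1 : ℝ)) 1 ^ 2) := by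
    refine (abs_integral_le_integral_abs).trans ?_
    have := integral_mono iX.abs iQP pd
    rwa [eQP] at this
  -- nonnegativity of the coercive integrals
  have hH0 : 0 ≤ ∫ x : EuclideanSpace ℝ (Fin 3), γ (x 2) * (fderiv ℝ v x (EuclideanSpace.single (0 : Fin 3) (1 : ℝ)) 0 ^ 2 + fderiv ℝ v x (EuclideanSpace.single (1 : Fin 3) (1 : ℝ)) 0 ^ 2 + fderiv ℝ v x (EuclideanSpace.single (0 : Fin 3) (1 : ℝ)) 1 ^ 2 + fderiv ℝ v x (EuclideanSpace.single (1 : Fin 3) (1 : ℝ)) 1 ^ 2) := integral_nonneg fun x => mul_nonneg (hγ0 _) (by positivity)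
  have hP0 : 0 ≤ ∫ x : EuclideanSpace ℝ (Fin 3), γ (x 2) * (fderiv ℝ v x (EuclideanSpace.single (2 : Fin 3) (1 : ℝ)) 0 ^ 2 + fderiv ℝ v x (EuclideanSpace.single (2 : Fin 3) (1 : ℝ)) 1 ^ 2) := integral_nonneg fun x => mul_nonneg (hγ0 _) (by positivity)
  have hQ0 : 0 ≤ ∫ x : EuclideanSpace ℝ (Fin 3), γ (x 2) * (fderiv ℝ v x (EuclideanSpace.single (0 : Fin 3) (1 : ℝ)) 2 ^ 2 + fderiv ℝ v x (EuclideanSpace.single (1 : Fin 3) (1 : ℝ)) 2 ^ 2) := integral_nonneg fun x => mul_nonneg (hγ0 _) (by positivity)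
  have hR0 : 0 ≤ ∫ x : EuclideanSpace ℝ (Fin 3), γ (x 2) * fderiv ℝ v x (EuclideanSpace.single (2 : Fin 3) (1 : ℝ)) 2 ^ 2 := integral_nonneg fun x => mul_nonneg (hγ0 _) (by positivity)
  -- assemble
  have hXle := (abs_le.mp Id)
  rw [eA, hplanar, eF]
  linarith [hXle.1, hXle.2, Ib, Ic, hH0, hP0, hQ0, hR0]

end ExtremiserLiouville

end Summit.NavierStokesRegularity.NavierStokesRegularity.Theorems

end
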